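import Summits.CriticalPhenomena.PercolationContinuityZ3.Theorems.PercNearOneGluingNoHeavyLowerTailMajorityGluingQCertSymParts
import HarnessLib

/-!
# Part 5 of 18 of the orbit certificate of the cell `(12,7)` at `c = 157/100`: data and digest (lane prim-rate, constants-miner 1, gen 36; generated by cert/mksym.py)

Support file for the closed crux `NoHeavyLowerTail` (stmt-CriticalPhenomena-4575), majority-gluing line.  The symmetrised certificate of the cell `(12,7)`
(kit j286395, symcert.py) is checked IN PARTS (`…MajorityGluingQCertSymParts`): this file holds part 5 (0 multiplier terms, 2 marginal slacks,
0 rows, 0 squares; 4098 contributions) and its DIGEST `twelveSevenSymP5D` (35 orbit keys), verified by `decide +kernel` (`twelveSevenSymP5_digest`).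
The parts are glued in `…MajorityGluingQCertSymTwelveSeven`.  No sorries. [cite: VandenbergKahn2001, Thm 1.2 (p. 123)]
-/

namespace Summit.CriticalPhenomena.PercolationContinuityZ3.Theorems

namespace HubOnly
namespace QCert

/-- Row representatives of part 5: `(A, X, B, Y, n, masks of f(A,X), f(B,Y), f(A∪B,X∩Y), f(∅,X∪Y))`. -/
def twelveSevenSymP5Rows : List RowE :=
  []

/-- Square representatives of part 5: `(a, b, n, mask₁, mask₂)`. -/
def twelveSevenSymP5Sqs : List SqE :=
  []

/-- **Part 5** of the `(12,7)` orbit certificate at `157/100`. -/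
def twelveSevenSymP5 : SymCert :=
  ⟨⟨12, 7, 157, 100, 1, [], [], []⟩,
    [],
    [(0, 3, 3190349719081936384), (0, 4094, 31666667)],
    [twelveSevenSymP5Rows], [twelveSevenSymP5Sqs]⟩

/-- The digest of part 5: `(orbit key, coefficient total)` in increasing key order (computed by cert/mksym.py, verified below). -/
def twelveSevenSymP5D : List (ℕ × ℤ) :=
  [((4100 : ℕ), (3190349719081936384 : ℤ)), (8191, 31666667), (12294, 3190349719081936384), (12296, 31903497190819363840), 
    (12298, 31903497190819363840), (12304, 143565737358687137280), (12306, 143565737358687137280), (12320, 382841966289832366080), 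
    (12322, 382841966289832366080), (12352, 669973441007206640640), (12354, 669973441007206640640), (12416, 803968129208647968768), 
    (12418, 803968129208647968768), (12544, 669973441007206640640), (12546, 669973441007206640640), (12800, 382841966289832366080), 
    (12802, 382841966289832366080), (13312, 143565737358687137280), (13314, 143565737358687137280), (14336, 31903497190819363840), 
    (14338, 31903497190819363840), (16384, 3190349719430269721), (16386, 3190349719081936384), (32770, 1741666685), (65542, 5225000055), 
    (131086, 10450000110), (262174, 14630000154), (524350, 14630000154), (1048702, 10450000110), (2097406, 5225000055), (4194814, 1741666685), 
    (8389630, 348333337), (8390654, 31666667), (16781315, -3190349719081936384), (16783359, -31666667)]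

/-- **The digest of part 5 is `twelveSevenSymP5D`** (kernel evaluation of the part's 4098 contributions). -/
theorem twelveSevenSymP5_digest : twelveSevenSymP5.digest 20 = twelveSevenSymP5D := by
  decide +kernel

end QCert
end HubOnly

end Summit.CriticalPhenomena.PercolationContinuityZ3.Theorems
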